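import Summits.CriticalPhenomena.PercolationContinuityZ3.Theorems.SahiMasterFamilyPointwisePrincipalCapSix
import Summits.CriticalPhenomena.PercolationContinuityZ3.Theorems.SahiMasterFamilyPointwisePrivate
import Summits.CriticalPhenomena.PercolationContinuityZ3.Theorems.SahiMasterFamilySupport
import Summits.CriticalPhenomena.PercolationContinuityZ3.Theorems.SahiMasterFamilyMinorClosed
import Summits.CriticalPhenomena.PercolationContinuityZ3.Theorems.SahiMasterFamilyL3Reduce

/-!
# Face-vanishing at the SHARED coordinates suffices: `C_k` and the pointwise master conjecture for every `k ≤ 6`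

Unit `prim-master-conj` (crux anchor stmt-CriticalPhenomena-4575, helper work), gen 13.  Call a coordinate `e` SHARED for a family `U` of increasing
events if at least two members depend on it (`Affects (U i) e`, `Affects (U j) e`, `i ≠ j`), PRIVATE otherwise.  The face-vanishing theorems of this
generation (`…PointwisePrincipalCapSix`: `C_k` and `E_k(μ_p;1_U) = 0 ↔ U ∈ Z_k` at interior `p`, every `k ≤ 6`, when ALL one-coordinate minors are zero
flags) extend to the larger class in which only the minors at SHARED coordinates are asked to be zero flags:

* `sahiE_ind_nonneg_and_eq_zero_iff_of_sharedFaceVanishing` — for `k = n+2 ≤ 6` increasing events such that `U^{e←b} ∈ Z_k` for every shared `e`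
  and both `b`, and `p` in the open cube: `E_k(μ_p; 1_U) ≥ 0` and `E_k(μ_p; 1_U) = 0 ↔ U ∈ Z_k` (`…_pos_…`: `> 0` off `Z_k`); `C_k` at EVERY `p`
  (`sahiE_ind_nonneg_of_sharedFaceVanishing'`, the same induction with positivity only);
* order three (`sahiE_three_ind_pos_of_sharedFaceVanishing`): Kahn's inequality, strictly off `Z_3`, for every triple of increasing events whose minors
  at the coordinates essential to at least two members are zero flags — private structure of any size is allowed anywhere.
PROOF: induction on the joint essential support.  If some essential coordinate `e` is private to `U_i`, the two section families `U[i ↦ U_i^{e←b}]`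
have smaller joint support and inherit the hypothesis (their minors at a shared `f` are private `e`-sections of the zero flag `U^{f←b'}`, and `Z_k` is
minor-closed, `suppZeroFlag_secAt_family`), so the law-level private inheritance of `…PointwisePrivate` (`E_k` affine in `p_e`, Lemma P) applies;
if every essential coordinate is shared, `U` is face-vanishing with respect to its joint support.  Axioms standard. [this work]
-/

noncomputable section

open scoped Classical

namespace Summit.CriticalPhenomena.PercolationContinuityZ3.Theorems

open Finset Function
open Literature.Combinatorics.Sahi2008
open Literature.Probability.LatticeModels.Kahn2022 (Affects)
open Literature.Probability.Percolation (DeterminedBy)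
open Literature.Probability.Percolation.DecisionTree (ind)

namespace Pointwise

variable {ι : Type} [Fintype ι]

/-! ### 1. Section families along a private coordinate: supports and minors -/

/-- Sectioning one member does not enlarge essential supports. [this work] -/
theorem esupp_update_secAt_subset {k : ℕ} (U : Fin k → Set (Set ι)) (hU : ∀ j, IsUpperSet (U j)) (i : Fin k) (e : ι) (b : Bool)
    (j : Fin k) : esupp (update U i (secAt e b (U i)) j) ⊆ esupp (U j) := by
  by_cases h : j = i
  · subst h; rw [update_self]; exact (esupp_secAt_subset (hU j) e b).trans (erase_subset _ _)
  · rw [update_of_ne h]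

/-- After sectioning `U_i` at a coordinate private to `U_i`, no member depends on it. [this work] -/
theorem not_mem_esupp_update_secAt {k : ℕ} (U : Fin k → Set (Set ι)) (i : Fin k) (e : ι)
    (hpriv : ∀ j, j ≠ i → ¬ Affects (U j) e) (b : Bool) (j : Fin k) : e ∉ esupp (update U i (secAt e b (U i)) j) := by
  intro he
  rw [mem_esupp] at he
  by_cases h : j = i
  · subst h; rw [update_self] at he; exact not_affects_secAt e b (U j) he
  · rw [update_of_ne h] at he; exact hpriv j h he

omit [Fintype ι] in
/-- Minors of a section family: for `f ≠ e`, `(U[i ↦ U_i^{e←b}])^{f←b'} = (U^{f←b'})[i ↦ (U_i^{f←b'})^{e←b}]`. [this work] -/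
theorem secAt_update_secAt_eq {k : ℕ} (U : Fin k → Set (Set ι)) (i : Fin k) {e f : ι} (hfe : f ≠ e) (b b' : Bool) :
    (fun j => secAt f b' (update U i (secAt e b (U i)) j)) =
      update (fun j => secAt f b' (U j)) i (secAt e b (secAt f b' (U i))) := by
  funext j
  by_cases h : j = i
  · subst h; rw [update_self, update_self, secAt_comm hfe]
  · rw [update_of_ne h, update_of_ne h]

omit [Fintype ι] in
/-- Along a coordinate private to `W_i`, the full minor of `W` is the one-member section family. [this work] -/
theorem secAt_family_eq_update_of_private {k : ℕ} (W : Fin k → Set (Set ι)) (hW : ∀ j, IsUpperSet (W j)) (i : Fin k) (e : ι)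
    (hpriv : ∀ j, j ≠ i → ¬ Affects (W j) e) (b : Bool) :
    (fun j => secAt e b (W j)) = update W i (secAt e b (W i)) := by
  funext j
  by_cases h : j = i
  · subst h; rw [update_self]
  · rw [update_of_ne h, secAt_eq_self_of_not_affects (hW j) (hpriv j h) b]

omit [Fintype ι] in
/-- `Z_k` is closed under sectioning one member at a coordinate private to it. [this work] -/
theorem suppZeroFlag_update_secAt_of_private {k : ℕ} (W : Fin k → Set (Set ι)) (hW : ∀ j, IsUpperSet (W j)) (i : Fin k) (e : ι)
    (hpriv : ∀ j, j ≠ i → ¬ Affects (W j) e) (b : Bool) (hZ : SuppZeroFlag k W) :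
    SuppZeroFlag k (update W i (secAt e b (W i))) := by
  rw [← secAt_family_eq_update_of_private W hW i e hpriv b]
  exact suppZeroFlag_secAt_family e b k W hZ

/-! ### 2. The induction on the joint essential support -/

/-- **`C_k` and the pointwise statement for shared-face-vanishing families, `k = n+2 ≤ 6`** (induction on the size of the joint essential support;
see the module docstring). [this work] -/
theorem sahiE_ind_nonneg_and_eq_zero_iff_of_sharedFaceVanishing {n : ℕ} (hn : n + 2 ≤ 6) (p : ι → unitInterval)
    (hp : ∀ e, (p e : ℝ) ∈ Set.Ioo (0 : ℝ) 1) :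
    ∀ (m : ℕ) (U : Fin (n + 2) → Set (Set ι)), (univ.biUnion fun j => esupp (U j)).card = m → (∀ j, IsUpperSet (U j)) →
      (∀ e, (∃ i j, i ≠ j ∧ Affects (U i) e ∧ Affects (U j) e) → ∀ b : Bool, SuppZeroFlag (n + 2) (fun j => secAt e b (U j))) →
        0 ≤ sahiE (bernoulliWeight p) (n + 2) (fun j => ind (U j)) ∧
          (sahiE (bernoulliWeight p) (n + 2) (fun j => ind (U j)) = 0 ↔ SuppZeroFlag (n + 2) U) := by
  intro m
  induction m using Nat.strong_induction_on with
  | _ m ih =>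
  intro U hm hU hsh
  by_cases hpriv : ∃ e ∈ (univ.biUnion fun j => esupp (U j)), ∃ i, ∀ j, j ≠ i → ¬ Affects (U j) e
  · -- an essential coordinate private to `U_i`: section `U_i` there and use the private inheritance
    obtain ⟨e, heT, i, hpi⟩ := hpriv
    have key : ∀ b : Bool,
        0 ≤ sahiE (bernoulliWeight p) (n + 2) (fun j => ind (update U i (secAt e b (U i)) j)) ∧
          (sahiE (bernoulliWeight p) (n + 2) (fun j => ind (update U i (secAt e b (U i)) j)) = 0 ↔
            SuppZeroFlag (n + 2) (update U i (secAt e b (U i)))) := by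
      intro b
      refine ih _ ?_ (update U i (secAt e b (U i))) rfl (isUpperSet_update_secAt hU i e b) ?_
      · -- the joint support shrinks: it loses `e`
        have hsub : (univ.biUnion fun j => esupp (update U i (secAt e b (U i)) j)) ⊆
            (univ.biUnion fun j => esupp (U j)).erase e := by
          intro f hf
          obtain ⟨j, -, hj⟩ := mem_biUnion.1 hf
          refine mem_erase.2 ⟨?_, mem_biUnion.2 ⟨j, mem_univ _, esupp_update_secAt_subset U hU i e b j hj⟩⟩
          rintro rfl
          exact not_mem_esupp_update_secAt U i f hpi b j hj
        rw [← hm]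
        exact lt_of_le_of_lt (card_le_card hsub) (card_erase_lt_of_mem heT)
      · -- shared minors of the section family are zero flags
        rintro f ⟨i', j', hij, hi', hj'⟩ b'
        have hfe : f ≠ e := by
          rintro rfl
          exact not_mem_esupp_update_secAt U i f hpi b i' (mem_esupp.2 hi')
        have hshU : ∃ i j, i ≠ j ∧ Affects (U i) f ∧ Affects (U j) f :=
          ⟨i', j', hij, mem_esupp.1 (esupp_update_secAt_subset U hU i e b i' (mem_esupp.2 hi')),
            mem_esupp.1 (esupp_update_secAt_subset U hU i e b j' (mem_esupp.2 hj'))⟩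
        have hZ := hsh f hshU b'
        rw [secAt_update_secAt_eq U i hfe b b']
        refine suppZeroFlag_update_secAt_of_private (fun j => secAt f b' (U j)) (fun j => isUpperSet_secAt f b' (hU j)) i e
          (fun j hj hje => hpi j hj ?_) b hZ
        -- `e` stays private to `i` after sectioning at `f`
        have := esupp_secAt_subset (hU j) f b' (mem_esupp.2 hje)
        exact mem_esupp.1 (mem_of_mem_erase this)
    obtain ⟨h0, hz0⟩ := key false
    obtain ⟨h1, hz1⟩ := key true
    exact ⟨sahiE_ind_nonneg_of_private_sections p U hU i e hpi h0 h1,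
      sahiE_ind_eq_zero_iff_of_private_sections p hp U hU i e hpi h0 h1 hz0.1 hz1.1⟩
  · -- every essential coordinate is shared: `U` is face-vanishing with respect to its joint essential support
    push Not at hpriv
    set T : Finset ι := univ.biUnion fun j => esupp (U j) with hT
    have hUS : ∀ j, DeterminedBy (U j) (↑T : Set ι) := fun j =>
      (determinedBy_esupp (hU j)).mono (coe_subset.2 (subset_biUnion_of_mem (fun j => esupp (U j)) (mem_univ j)))
    have hall : ∀ e ∈ T, ∀ b : Bool, SuppZeroFlag (n + 2) (fun j => secAt e b (U j)) := by
      intro e he b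
      obtain ⟨j₀, -, hj₀⟩ := mem_biUnion.1 he
      obtain ⟨j₁, hj₁, hj₁e⟩ := hpriv e he j₀
      exact hsh e ⟨j₁, j₀, hj₁, hj₁e, mem_esupp.1 hj₀⟩ b
    exact ⟨sahiE_ind_nonneg_of_faceVanishing_of_le_six hn p U T hU hUS hall,
      sahiE_ind_eq_zero_iff_of_faceVanishing_of_le_six hn p hp U T hU hUS hall⟩

/-! ### 3. Statements -/

/-- **Sahi's `C_k` for shared-face-vanishing families, `k = n+2 ≤ 6`**, at interior `p`. [this work] -/
theorem sahiE_ind_nonneg_of_sharedFaceVanishing {n : ℕ} (hn : n + 2 ≤ 6) (p : ι → unitInterval)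
    (hp : ∀ e, (p e : ℝ) ∈ Set.Ioo (0 : ℝ) 1) (U : Fin (n + 2) → Set (Set ι)) (hU : ∀ j, IsUpperSet (U j))
    (hsh : ∀ e, (∃ i j, i ≠ j ∧ Affects (U i) e ∧ Affects (U j) e) → ∀ b : Bool, SuppZeroFlag (n + 2) (fun j => secAt e b (U j))) :
    0 ≤ sahiE (bernoulliWeight p) (n + 2) (fun j => ind (U j)) :=
  (sahiE_ind_nonneg_and_eq_zero_iff_of_sharedFaceVanishing hn p hp _ U rfl hU hsh).1

/-- **The pointwise master conjecture for shared-face-vanishing families, `k = n+2 ≤ 6`**: at interior `p`, `E_k(μ_p; 1_U) = 0 ↔ U ∈ Z_k`.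
[this work] -/
theorem sahiE_ind_eq_zero_iff_of_sharedFaceVanishing {n : ℕ} (hn : n + 2 ≤ 6) (p : ι → unitInterval)
    (hp : ∀ e, (p e : ℝ) ∈ Set.Ioo (0 : ℝ) 1) (U : Fin (n + 2) → Set (Set ι)) (hU : ∀ j, IsUpperSet (U j))
    (hsh : ∀ e, (∃ i j, i ≠ j ∧ Affects (U i) e ∧ Affects (U j) e) → ∀ b : Bool, SuppZeroFlag (n + 2) (fun j => secAt e b (U j))) :
    sahiE (bernoulliWeight p) (n + 2) (fun j => ind (U j)) = 0 ↔ SuppZeroFlag (n + 2) U :=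
  (sahiE_ind_nonneg_and_eq_zero_iff_of_sharedFaceVanishing hn p hp _ U rfl hU hsh).2

/-- **Strict positivity off `Z_k`** for shared-face-vanishing families, `k = n+2 ≤ 6`, at interior `p`. [this work] -/
theorem sahiE_ind_pos_of_sharedFaceVanishing {n : ℕ} (hn : n + 2 ≤ 6) (p : ι → unitInterval)
    (hp : ∀ e, (p e : ℝ) ∈ Set.Ioo (0 : ℝ) 1) (U : Fin (n + 2) → Set (Set ι)) (hU : ∀ j, IsUpperSet (U j))
    (hsh : ∀ e, (∃ i j, i ≠ j ∧ Affects (U i) e ∧ Affects (U j) e) → ∀ b : Bool, SuppZeroFlag (n + 2) (fun j => secAt e b (U j)))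
    (hZ : ¬ SuppZeroFlag (n + 2) U) : 0 < sahiE (bernoulliWeight p) (n + 2) (fun j => ind (U j)) :=
  lt_of_le_of_ne (sahiE_ind_nonneg_of_sharedFaceVanishing hn p hp U hU hsh)
    (fun h0 => hZ ((sahiE_ind_eq_zero_iff_of_sharedFaceVanishing hn p hp U hU hsh).1 h0.symm))

/-- **Order three — Kahn's inequality, strictly, when the shared minors vanish**: for three increasing events whose one-coordinate minors at every
coordinate essential to at least two of them are in `Z_3` (private structure arbitrary), `E_3(μ_p; 1_U) > 0` at every interior `p` unless `U ∈ Z_3`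
(where it is `0`). [this work] -/
theorem sahiE_three_ind_pos_of_sharedFaceVanishing (p : ι → unitInterval) (hp : ∀ e, (p e : ℝ) ∈ Set.Ioo (0 : ℝ) 1)
    (U : Fin 3 → Set (Set ι)) (hU : ∀ j, IsUpperSet (U j))
    (hsh : ∀ e, (∃ i j, i ≠ j ∧ Affects (U i) e ∧ Affects (U j) e) → ∀ b : Bool, SuppZeroFlag 3 (fun j => secAt e b (U j)))
    (hZ : ¬ SuppZeroFlag 3 U) : 0 < sahiE (bernoulliWeight p) 3 (fun j => ind (U j)) :=
  sahiE_ind_pos_of_sharedFaceVanishing (n := 1) (by norm_num) p hp U hU hsh hZ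

/-! ### 4. `C_k` at every parameter (the same induction, positivity only) -/

/-- **Sahi's `C_k` for shared-face-vanishing families at EVERY `p ∈ [0,1]^ι`, `k = n+2 ≤ 6`.** [this work] -/
theorem sahiE_ind_nonneg_of_sharedFaceVanishing_all {n : ℕ} (hn : n + 2 ≤ 6) (p : ι → unitInterval) :
    ∀ (m : ℕ) (U : Fin (n + 2) → Set (Set ι)), (univ.biUnion fun j => esupp (U j)).card = m → (∀ j, IsUpperSet (U j)) →
      (∀ e, (∃ i j, i ≠ j ∧ Affects (U i) e ∧ Affects (U j) e) → ∀ b : Bool, SuppZeroFlag (n + 2) (fun j => secAt e b (U j))) →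
        0 ≤ sahiE (bernoulliWeight p) (n + 2) (fun j => ind (U j)) := by
  intro m
  induction m using Nat.strong_induction_on with
  | _ m ih =>
  intro U hm hU hsh
  by_cases hpriv : ∃ e ∈ (univ.biUnion fun j => esupp (U j)), ∃ i, ∀ j, j ≠ i → ¬ Affects (U j) e
  · obtain ⟨e, heT, i, hpi⟩ := hpriv
    have key : ∀ b : Bool, 0 ≤ sahiE (bernoulliWeight p) (n + 2) (fun j => ind (update U i (secAt e b (U i)) j)) := by
      intro b
      refine ih _ ?_ (update U i (secAt e b (U i))) rfl (isUpperSet_update_secAt hU i e b) ?_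
      · have hsub : (univ.biUnion fun j => esupp (update U i (secAt e b (U i)) j)) ⊆
            (univ.biUnion fun j => esupp (U j)).erase e := by
          intro f hf
          obtain ⟨j, -, hj⟩ := mem_biUnion.1 hf
          refine mem_erase.2 ⟨?_, mem_biUnion.2 ⟨j, mem_univ _, esupp_update_secAt_subset U hU i e b j hj⟩⟩
          rintro rfl
          exact not_mem_esupp_update_secAt U i f hpi b j hj
        rw [← hm]
        exact lt_of_le_of_lt (card_le_card hsub) (card_erase_lt_of_mem heT)
      · rintro f ⟨i', j', hij, hi', hj'⟩ b'
        have hfe : f ≠ e := by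
          rintro rfl
          exact not_mem_esupp_update_secAt U i f hpi b i' (mem_esupp.2 hi')
        have hshU : ∃ i j, i ≠ j ∧ Affects (U i) f ∧ Affects (U j) f :=
          ⟨i', j', hij, mem_esupp.1 (esupp_update_secAt_subset U hU i e b i' (mem_esupp.2 hi')),
            mem_esupp.1 (esupp_update_secAt_subset U hU i e b j' (mem_esupp.2 hj'))⟩
        rw [secAt_update_secAt_eq U i hfe b b']
        refine suppZeroFlag_update_secAt_of_private (fun j => secAt f b' (U j)) (fun j => isUpperSet_secAt f b' (hU j)) i e
          (fun j hj hje => hpi j hj ?_) b (hsh f hshU b')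
        exact mem_esupp.1 (mem_of_mem_erase (esupp_secAt_subset (hU j) f b' (mem_esupp.2 hje)))
    exact sahiE_ind_nonneg_of_private_sections p U hU i e hpi (key false) (key true)
  · push Not at hpriv
    set T : Finset ι := univ.biUnion fun j => esupp (U j) with hT
    have hUS : ∀ j, DeterminedBy (U j) (↑T : Set ι) := fun j =>
      (determinedBy_esupp (hU j)).mono (coe_subset.2 (subset_biUnion_of_mem (fun j => esupp (U j)) (mem_univ j)))
    have hall : ∀ e ∈ T, ∀ b : Bool, SuppZeroFlag (n + 2) (fun j => secAt e b (U j)) := by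
      intro e he b
      obtain ⟨j₀, -, hj₀⟩ := mem_biUnion.1 he
      obtain ⟨j₁, hj₁, hj₁e⟩ := hpriv e he j₀
      exact hsh e ⟨j₁, j₀, hj₁, hj₁e, mem_esupp.1 hj₀⟩ b
    exact sahiE_ind_nonneg_of_faceVanishing_of_le_six hn p U T hU hUS hall

/-- **`C_k` at every `p`** (packaged). [this work] -/
theorem sahiE_ind_nonneg_of_sharedFaceVanishing' {n : ℕ} (hn : n + 2 ≤ 6) (p : ι → unitInterval)
    (U : Fin (n + 2) → Set (Set ι)) (hU : ∀ j, IsUpperSet (U j))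
    (hsh : ∀ e, (∃ i j, i ≠ j ∧ Affects (U i) e ∧ Affects (U j) e) → ∀ b : Bool, SuppZeroFlag (n + 2) (fun j => secAt e b (U j))) :
    0 ≤ sahiE (bernoulliWeight p) (n + 2) (fun j => ind (U j)) :=
  sahiE_ind_nonneg_of_sharedFaceVanishing_all hn p _ U rfl hU hsh


end Pointwise

end Summit.CriticalPhenomena.PercolationContinuityZ3.Theorems
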